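import Literature.AlgebraicTopology.SingularHomology.SingularChainsConcrete
import Literature.AlgebraicTopology.SingularHomology.ChainSubcomplex
import Literature.AlgebraicTopology.SingularHomology.RelativeHomology
import Mathlib.Algebra.Homology.HomologicalComplexLimits
import HarnessLib

/-!
# Compact supports of singular homology classes

A. Hatcher, *Algebraic Topology*, CUP 2002, §2.1 and §3.3: a singular chain is a finite sum of
singular simplices, each with compact image, so every (relative) homology class "lives on" a
compact subset. We prove the two forms used in §3.3 (proof of Lemma 3.27, step (4), p. 238, and
proof of Prop. 3.33, p. 244: "a cycle in `X` is a finite sum of singular simplices with compact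
image"), sorry-free and for an arbitrary coefficient module:

* `Literature.AlgebraicTopology.SingularHomology.singularHomology.exists_isCompact_mem_range_map`: every `β ∈ Hₖ(Y; M)` is in the image of
  `Hₖ(C; M) → Hₖ(Y; M)` for some compact `C ⊆ Y` (the carrier of a representing cycle);
* `Literature.AlgebraicTopology.SingularHomology.relativeSingularHomology.exists_isCompact_forall_mem_range_map`: for every
  `α ∈ Hᵢ(X, U; M)` there is a compact `C ⊆ U` such that `α` is in the image of
  `Hᵢ(X, V; M) → Hᵢ(X, U; M)` for every `V` with `C ⊆ V ⊆ U` (Hatcher p. 238: the relative cycle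
  `z` "defines an element `α_K ∈ Hᵢ(ℝⁿ | K)` mapping to the given `α`" as soon as `K` misses the
  compact image `C` of `∂z`). The relative form is deduced from the absolute one by a diagram chase
  in the long exact sequences of the pairs `(X, V)`, `(X, U)`.

The chain-level input is the concrete chain model `Literature.AlgebraicTopology.SingularHomology.csingularChainComplex` with its carrier
`Literature.AlgebraicTopology.SingularHomology.CChain.carrier` and the comparison `Literature.AlgebraicTopology.SingularHomology.csingularHomology.compIso` with Mathlib's singular
homology (file `SingularChainsConcrete`), and the cycle/class dictionary `Literature.AlgebraicTopology.SingularHomology.homologyCls` (file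
`ChainSubcomplex`).

## References

* A. Hatcher, *Algebraic Topology*, CUP 2002, §2.1; §3.3, pp. 238, 244.
-/

noncomputable section

-- The identification `(csingularChainComplex R M X).X n = ModuleCat.of R (CChain M X n)` holds up
-- to unfolding semireducible definitions; as in `SingularChainsConcrete` we relax transparency.
set_option backward.isDefEq.respectTransparency false

open CategoryTheory Limits Topology Set

universe u v

namespace Literature.AlgebraicTopology.SingularHomology

variable (R : Type v) [CommRing R] (M : Type v) [AddCommGroup M] [Module R M]
variable {X : Type u} [TopologicalSpace X]

/-! ### Absolute classes -/

namespace singularHomology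

/-- **Compact supports of homology classes** (Hatcher 2002, §3.3, proof of Prop. 3.33, p. 244: "a
cycle is a finite sum of singular simplices with compact image"; also proof of Lemma 3.27, step
(4), p. 238). Every class `β ∈ Hₖ(Y; M)` is the image of a class of `Hₖ(C; M)` under the map
induced by the inclusion of a compact subspace `C ⊆ Y` — namely the carrier of a cycle
representing `β` in the concrete chain model. [cite: Hatcher2002, §3.3  proof of Prop. 3.33  p. 244] -/
theorem exists_isCompact_mem_range_map {Y : Type u} [TopologicalSpace Y] {k : ℕ}
    (β : singularHomology R M Y k) :
    ∃ C : Set Y, IsCompact C ∧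
      β ∈ Set.range (singularHomology.map R M (⟨Subtype.val, continuous_subtype_val⟩ : C(C, Y)) k) := by
  -- pass to the concrete model
  set β' : csingularHomology R M Y k := (csingularHomology.compIso R M Y k).inv β with hβ'
  obtain ⟨z, hz, hzβ⟩ := homologyCls_surjective β'
  -- the carrier of the representing cycle
  let c : CChain M Y k := z
  refine ⟨CChain.carrier c, CChain.isCompact_carrier c, ?_⟩
  set C : Set Y := CChain.carrier c with hC
  let ι : C(C, Y) := ⟨Subtype.val, continuous_subtype_val⟩
  -- the cycle comes from a chain of the subspace `C`
  have hcC : c ∈ chainsIn R M Y C k := CChain.mem_chainsIn_carrier R c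
  rw [← range_lmapDomain_val] at hcC
  obtain ⟨z₀, hz₀⟩ := hcC
  have hmap : (csingularChainComplex.map R M ι).f k z₀ = z := hz₀
  -- which is a cycle, by injectivity of the inclusion of chains
  have hz₀c : (csingularChainComplex R M C).d k ((ComplexShape.down ℕ).next k) z₀ = 0 := by
    apply mapDomain_val_injective (M := M) C ((ComplexShape.down ℕ).next k)
    change (csingularChainComplex.map R M ι).f _ ((csingularChainComplex R M C).d k _ z₀) =
      Finsupp.mapDomain _ 0
    rw [Finsupp.mapDomain_zero, ← ModuleCat.comp_apply, ← (csingularChainComplex.map R M ι).comm,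
      ModuleCat.comp_apply, hmap, hz]
  refine ⟨(csingularHomology.compIso R M C k).hom (homologyCls z₀ hz₀c), ?_⟩
  rw [← ModuleCat.comp_apply, ← csingularHomology.map_comp_compIso_hom, ModuleCat.comp_apply,
    csingularHomology.map, homologyMap_homologyCls, homologyCls_congr hmap _ hz, hzβ, hβ',
    ← ModuleCat.comp_apply, Iso.inv_hom_id, ModuleCat.id_apply]

end singularHomology

/-! ### Relative classes -/

namespace relativeSingularHomology

/-- In degree `0`, `j_* : H₀(X; M) ⟶ H₀(X, A; M)` is surjective (the long exact sequence of the
pair ends with `H₀(X) → H₀(X, A) → 0`; Hatcher 2002, §2.1, Thm. 2.13 ff.). [cite: Hatcher2002, §2.1  Thm. 2.13 ff.] -/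
theorem ofAbsolute_zero_surjective (A : Set X) :
    Function.Surjective (ofAbsolute R M X A 0) := by
  rw [← ModuleCat.epi_iff_surjective]
  exact HomologicalComplex.epi_homologyMap_of_epi_of_not_rel _ 0 (fun j h ↦ by
    simp only [ComplexShape.down_Rel] at h
    omega)

/-- **Compact supports of relative classes** (Hatcher 2002, §3.3, proof of Lemma 3.27, step (4),
p. 238: if `z` is a relative cycle for `(X, U)` and `C ⊆ U` is the (compact) image of `∂z`, then
`z` "defines an element" of `Hᵢ(X, V)` mapping to `[z]` for every `V ⊇ C`). For every
`α ∈ Hᵢ(X, U; M)` there is a compact `C ⊆ U` such that for all `V` with `C ⊆ V ⊆ U`, `α` is in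
the image of `Hᵢ(X, V; M) ⟶ Hᵢ(X, U; M)`. Proof: diagram chase in the long exact sequences of the
pairs `(X, V)` and `(X, U)`, starting from a compact support of `∂α ∈ Hᵢ₋₁(U)`.
[cite: Hatcher2002, §3.3  proof of Lemma 3.27 step (4)  p. 238] -/
theorem exists_isCompact_forall_mem_range_map (U : Set X) {i : ℕ}
    (α : relativeSingularHomology R M X U i) :
    ∃ C : Set X, IsCompact C ∧ C ⊆ U ∧ ∀ (V : Set X), C ⊆ V → ∀ hVU : V ⊆ U,
      α ∈ Set.range (map R M (ContinuousMap.id X) (fun _ hx ↦ hVU hx : Set.MapsTo _ V U) i) := by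
  cases i with
  | zero =>
    -- degree 0: every class comes from `H₀(X)`
    refine ⟨∅, isCompact_empty, empty_subset _, fun V _ hVU ↦ ?_⟩
    obtain ⟨γ, rfl⟩ := ofAbsolute_zero_surjective R M U α
    refine ⟨ofAbsolute R M X V 0 γ, ?_⟩
    rw [← ModuleCat.comp_apply, ofAbsolute_comp_map, singularHomology.map_id, Category.id_comp]
  | succ i =>
    -- a compact support of `∂α ∈ Hᵢ(U)`
    obtain ⟨C₀, hC₀, β, hβ⟩ := singularHomology.exists_isCompact_mem_range_map R M (δ R M X U i α)
    refine ⟨Subtype.val '' C₀, hC₀.image continuous_subtype_val,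
      fun _ ⟨x, _, hx⟩ ↦ hx ▸ x.2, fun V hCV hVU ↦ ?_⟩
    have hVU' : Set.MapsTo (ContinuousMap.id X) V U := fun _ hx ↦ hVU hx
    -- `β` pushed into `Hᵢ(V)`
    let g : C(C₀, V) := ⟨fun z ↦ ⟨z.1.1, hCV ⟨z.1, z.2, rfl⟩⟩, by fun_prop⟩
    let ιVU : C(V, U) := subsetRestrict (ContinuousMap.id X) hVU'
    have hg : ιVU.comp g = (⟨Subtype.val, continuous_subtype_val⟩ : C(C₀, U)) := by
      ext z
      rfl
    set βV : singularHomology R M V i := singularHomology.map R M g i β with hβV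
    have hβVU : singularHomology.map R M ιVU i βV = δ R M X U i α := by
      rw [hβV, ← ModuleCat.comp_apply, ← singularHomology.map_comp, hg, hβ]
    -- `βV ↦ 0 ∈ Hᵢ(X)`, hence `βV = ∂α₁` for some `α₁ ∈ Hᵢ₊₁(X, V)`
    have hβX : singularHomology.map R M (⟨Subtype.val, continuous_subtype_val⟩ : C(V, X)) i βV = 0 := by
      have e : (⟨Subtype.val, continuous_subtype_val⟩ : C(V, X)) =
          (⟨Subtype.val, continuous_subtype_val⟩ : C(U, X)).comp ιVU := by
        ext z
        rfl
      rw [e, singularHomology.map_comp, ModuleCat.comp_apply, hβVU, ← ModuleCat.comp_apply,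
        δ_comp_map]
      rfl
    obtain ⟨α₁, hα₁⟩ := ((ShortComplex.moduleCat_exact_iff _).1 (exact_δ_map R M V i)) βV hβX
    -- `α - α₁|U` has zero boundary, hence comes from `Hᵢ₊₁(X)`
    have hδ : δ R M X U i (α - map R M (ContinuousMap.id X) hVU' (i + 1) α₁) = 0 := by
      rw [map_sub, ← ModuleCat.comp_apply, ← δ_naturality, ModuleCat.comp_apply]
      change δ R M X U i α - singularHomology.map R M ιVU i (δ R M X V i α₁) = 0
      rw [hα₁, hβVU, sub_self]
    obtain ⟨γ, hγ⟩ := ((ShortComplex.moduleCat_exact_iff _).1 (exact_ofAbsolute_δ R M U i)) _ hδ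
    refine ⟨α₁ + ofAbsolute R M X V (i + 1) γ, ?_⟩
    rw [map_add, ← ModuleCat.comp_apply, ofAbsolute_comp_map, singularHomology.map_id,
      Category.id_comp]
    change _ + ofAbsolute R M X U (i + 1) γ = α
    rw [hγ, add_sub_cancel]

end relativeSingularHomology

end Literature.AlgebraicTopology.SingularHomology
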